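import Literature.NumberTheory.LFunctions.RodgersTaoZeroDynamics
import Literature.NumberTheory.LFunctions.RodgersTaoNotation
import Mathlib.MeasureTheory.Function.AbsolutelyContinuous
import HarnessLib

/-!
# Rodgers–Tao 2020, §7 "Strong control on integrated energy": the renormalised energy `Ẽ`,
the truncated energy `Ẽ_T`, the renormalised Hamiltonian `H̃_T`, and Lemma 16 – Corollary 25

LITERATURE TYPING, AS PRINTED, with page locators. Trunk T-ANT
(`Literature/NumberTheory/LFunctions`). B. Rodgers, T. Tao, *The de Bruijn–Newman constant is
non-negative*, Forum Math. Pi 8 (2020) e6 = arXiv:1801.05914, **§7**. Version pinned: typed from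
the authors' arXiv **v4** TeX (l. 1014–1470; `\section{Strong control on integrated energy}`,
labels `eb`, `prelim`, `eb2`, `hamil-form`, `lrdec`, `neg`, `dorium`, `lame`, `core`) and **v5**
TeX (l. 978–1437; statement environments compared word by word: identical except that Theorem 17
writes `[0.5 T log T, 3T log T]_{ℤ*}` where v4/FMP print `[…]_ℤ`), and checked against the
published text FMP 8 (2020) e6 **pp. 39–57** (Lemma 16 p. 41; Theorem 17, display (65), p. 42;
Lemma 18 p. 42; (69)–(71) pp. 43–44; Lemma 19 p. 44; Lemma 20 p. 45; Lemma 21 p. 47;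
Proposition 22, display (76), and Remark 23 p. 48; Lemma 24 p. 54; Corollary 25 p. 56; end of
the proof of Theorem 17 p. 57). Numbering: arXiv v4 Lemma 7.1 / Thm. 7.2 / Lemma 7.3 / 7.4 / 7.5
/ 7.6 / Prop. 7.7 / Rem. 7.8 / Lemma 7.9 / Cor. 7.10 = v5 = FMP Lemma 16 / Thm. 17 / Lemma 18 /
19 / 20 / 21 / Prop. 22 / Rem. 23 / Lemma 24 / Cor. 25; equation numbers (62)–(89) are identical in
v4, v5 and FMP.

LINE 1 — LABEL. Every numbered statement of §7 is printed for times `Λ/2 ≤ t ≤ 0`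
(resp. `Λ/4 ≤ t ≤ 0`) under the standing hypothesis of §1.2 «we will assume for sake of
contradiction that Newman's conjecture fails: `Λ < 0`». That hypothesis is REFUTED in the tree
(`rodgers_tao_holds`, Newman's conjecture `Λ ≥ 0`, proved along Dobner 2021), and the source
itself says (Remark 5 = v4 Remark 2.2, FMP p. 8) that «in contrast to the remaining arguments in
this paper» only §2 could be made non-vacuous when `Λ ≥ 0`: the proofs of §7 consume (50)–(52)
(Cor. 10), Prop. 13, Prop. 15 and (56) (Thm. 11), all of which the source proves only for
`Λ < t ≤ 0`. Accordingly every named fact below is **VACUOUS-AS-PRINTED (Λ ≥ 0) / EX-FALSO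
class**: it is typed, exactly as `RodgersTaoEnergy.lean` types Thm. 17 (= 7.2) and §8, in the
tree's `sInf`-free WITNESS FORM — `Λ` is replaced by a witness `t₀ < 0` with `H_{t₀}` real-rooted
(so `Λ ≤ t₀ < 0`; for `t₀ = Λ`, which is an admissible witness by
`hasOnlyRealZeros_deBruijnH_deBruijnNewmanConst`, this is the printed statement verbatim, and for
other witnesses it is what the same printed proof gives) — and its antecedent
`t₀ < 0 ∧ HasOnlyRealZeros (deBruijnH t₀)` is unsatisfiable by `rodgers_tao_holds`. These facts
record WHICH statements §7 prints; a discharge of any of them is `0`-content (ex falso) unless it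
formalises the §7 argument from (50)–(52), Prop. 13, Prop. 15, (56). The definitions and the
elementary identities/inequalities (62), (63), (70), (71) are RH-FREE and proved here. Nothing in
this file bears on the truth of the Riemann hypothesis.

## What the source prints (FMP pp. 40–56; `x_j = x_j(t)`, indices in `ℤ*`, `Λ/2 ≤ t ≤ 0`)

> `V(x) := 1/|x|² − 1 + 2(|x| − 1)` … `V(x) ≍ 1/|x|²` for `|x| ≤ 1/2`, `≍ (|x| − 1)²` for
> `1/2 < |x| ≤ 2`, `≍ |x|` for `|x| > 2` (62). `Ẽ_{jk}(t) := V((x_k − x_j)/(ξ_k − ξ_j))/|ξ_k − ξ_j|²`;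
> `Ẽ_{jk}(t) = E_{jk}(t) − 1/|ξ_k − ξ_j|² + 2((x_k − ξ_k) − (x_j − ξ_j))/(ξ_k − ξ_j)³` (63).
> `Ẽ^I(t) := Σ_{j,k ∈ I : j ≠ k} Ẽ_{jk}(t)` for a discrete interval `I ⊂ ℤ*`.
> **Lemma 16.** If `I = [I₋, I₊]_{ℤ*}` is a discrete interval and `Λ/2 ≤ t ≤ 0`, then
> `Ẽ^I(t) = (Σ_{j,k ∈ I : j ≠ k} E_{jk}(t) − 1/|ξ_k − ξ_j|²) + O(log₊^{O(1)}(|I₋| + |I₊|))`.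
> **Theorem 17.** For any `T > 0`, `∫_{Λ/4}^0 Ẽ^{[0.5 T log T, 3T log T]_{ℤ*}}(t) dt = o_{T→∞}(T log³₊ T)` (65).
> `ψ_T(j) := (1 + |j|/(T log T))^{−100}` (66); `Ẽ_T(t) := Σ_{j,k ∈ ℤ* : j ≠ k} ψ_T(j)ψ_T(k)Ẽ_{jk}(t)` (67),
> «finite for almost every `Λ/2 ≤ t ≤ 0`».
> **Lemma 18.** For almost every `Λ/2 ≤ t ≤ 0`,
> `Ẽ_T(t) = (Σ_{j ≠ k} ψ_T(j)ψ_T(k)(E_{jk}(t) − 1/|ξ_k − ξ_j|²)) + Õ(1)`.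
> `H̃_T(t) := Σ_{j,k ∈ ℤ* : j ∼_T k} ψ_T(j)ψ_T(k)(H_{jk}(t) − log(1/|ξ_j − ξ_k|))` (69), «absolutely
> convergent for every `Λ/2 ≤ t ≤ 0`»; `L(x) := log(1/|x|) + |x| − 1`, «a convex non-negative
> function on `ℝ ∖ {0}` that vanishes precisely when `|x| = 1`», `L(x) ≍ log₊(1/|x|)`,
> `(|x| − 1)²`, `|x|` in the three regimes (70); `H̃_{jk}(t) := L((x_j − x_k)/(ξ_j − ξ_k))` (71).
> **Lemma 19.** For every `Λ/2 ≤ t ≤ 0`,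
> `H̃_T(t) = Σ_{j ∼_T k} ψ_T(j)ψ_T(k)H̃_{jk}(t) + o_{T→∞}(T log³₊ T)`.
> **Lemma 20** (Long-range decay of `H̃_{jk}`). Let `j ≠ k ∈ ℤ*`, `Λ/2 ≤ t ≤ 0`. There exists
> `ε(j) → 0` as `|j| → ∞` such that: `|k − j| ≥ ε(j)⁻¹ log²₊ ξ_j ⇒ H̃_{jk}(t) ≪ log⁴₊(|j|+|k|)/|k − j|²`;
> `ε(j) log²₊ ξ_j ≤ |k − j| ≤ ε(j)⁻¹ log²₊ ξ_j ⇒ H̃_{jk}(t) ≪ ε(j)² log⁴₊ j/|k − j|²`;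
> `|k − j| < ε(j) log²₊ ξ_j ⇒ H̃_{jk}(t) ≪ (log²₊ j) log₊ log₊ j`.
> «moderately sized» `:= O(T log³₊ T + Ẽ_T(t))`; «negligible» `:= o_{T→∞}(T log³₊ T + Ẽ_T(t))`.
> **Lemma 21.** `Λ/2 ≤ t ≤ 0`. (i) `Σ_{j ≠ k} ψψ/|x_j − x_k|²` is moderately sized; (ii)
> `(log₊ T) Σ_{j ≠ k} ψψ/|x_j − x_k|` is moderately sized; (iii) for absolute `C, c > 0`,
> `(log^C₊ T) Σ_{|j|,|k| ≤ T^{1−c}} ψψ/|x_j − x_k|` is negligible; (iv) same with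
> `|j|, |k| ≥ T^{1+c}`. «Similarly if the `x_i(t)` are replaced by `ξ_i` throughout.»
> **Proposition 22.** In the range `Λ/2 ≤ t ≤ 0`, `H̃_T` is absolutely continuous and
> `∂ₜ H̃_T(t) = −4 Ẽ_T(t) + o_{T→∞}(T log³ T + Ẽ_T(t))` (76) for almost every `t`.
> **Remark 23.** (Heuristic comparison with Lemma 12 (v) and (57); no statement.)
> **Lemma 24.** Let `m` be a natural number, `Λ/2 ≤ t ≤ 0`, `T > 0`, and let `δ = δ(T) → 0`
> sufficiently slowly. If `H̃_T(t) ≥ δ m T log³₊ T` then `Ẽ_T(t) ≫ δ 2^{2m} T log³₊ T`, the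
> implied constant absolute.
> **Corollary 25.** `H̃_T(t) = O(δ T log³₊ T)` for `Λ/4 ≤ t ≤ 0`.

## Contents (source item → declaration → status)

Definitions (real bodies; RH-FREE):
* (62) `V` is the tree's `renormPotential` (`RodgersTaoEnergy.lean`); the three regimes of (62)
  are PROVED here with explicit constants: `le_renormPotential_of_abs_le_half`,
  `renormPotential_le_of_abs_le_half`, `renormPotential_le_eight_mul_sq`,
  `renormPotential_le_two_mul_abs`, `abs_div_two_le_renormPotential` (with the tree's
  `sq_sub_one_le_renormPotential`, `sub_one_le_renormPotential`).
* `Ẽ_{jk}` on `ℤ*` → `renormEnergyZ t j k` (extends the tree's `ℕ`-indexed `renormEnergy`: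
  `renormEnergyZ_natCast`); `Ẽ^I` → `renormEnergyOnZ t I` (`I : Finset ℤ`;
  `renormEnergyOnZ_map_natCast` recovers `renormEnergyOn`); (63) PROVED:
  `renormEnergyZ_eq_interactionEnergy_sub` (via the algebraic `renormPotential_div_div_sq`).
* (66) `ψ_T` → `truncWeight T j`; (67) `Ẽ_T` → `truncEnergy T t` (a `tsum` over the index type
  `zstarOffDiag` of pairs `j ≠ k` in `ℤ*`, summand `truncEnergyTerm`; summability is asserted
  where the source asserts finiteness).
* (69) `H̃_T` → `truncHamiltonian T t` (a `tsum` over `nearbyPairs T`, summand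
  `truncHamiltonianTerm`); (70) `L` → `renormLog`, PROVED: `renormLog_nonneg`,
  `renormLog_eq_zero_iff`, and the regimes of (70) with explicit constants
  (`renormLog_le_logPlus_inv`, `renormLog_le_two_mul_sq`, `renormLog_le_abs`,
  `abs_div_sixteen_le_renormLog`; the two remaining lower bounds are proved in the companion
  proofs file); (71) `H̃_{jk}` → `renormHamiltonianZ t j k`, with the identity of the proof of
  Lemma 19 PROVED (`renormHamiltonianZ_eq_hamiltonianInteraction_sub`, SIGN CORRECTED, see
  Divergences).
* «moderately sized» / «negligible» → `IsModeratelySized t₀ F`, `IsNegligible t₀ F` (p. 47).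

Named facts (D-0014; VACUOUS-AS-PRINTED / EX-FALSO class, witness form; none is in the tree):
* Lemma 16 (= 7.1) → `rodgers_tao_renormEnergyOn_expansion`;
* Lemma 18 (= 7.3) → `rodgers_tao_truncEnergy_expansion`;
* Lemma 19 (= 7.4) → `rodgers_tao_truncHamiltonian_expansion`;
* Lemma 20 (= 7.5) → `rodgers_tao_renormHamiltonian_decay`;
* Lemma 21 (= 7.6) (i)–(iv) → `rodgers_tao_moderatelySized`; its «similarly with `ξ_i`» clause
  → `rodgers_tao_moderatelySized_xi` (typed literally, same class); the two RH-FREE displays of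
  its proof (p. 47 last display `Σ_{k ≠ j} 1/|ξ_j − ξ_k|² ≪ log²₊ j`; p. 48 first display
  `Σ_{j ≠ k} ψ_T(j)ψ_T(k)/|ξ_j − ξ_k|² ≪ T log³₊ T`) → `rodgers_tao_xi_inv_sq_sum_bound`,
  `rodgers_tao_truncWeight_xi_sq_sum_bound` (RH-FREE named facts about `ξ_j`, `ψ_T` only;
  dischargeable from Lemma 8 (ii) = (44));
* Proposition 22 (= 7.7) → `rodgers_tao_truncHamiltonian_deriv`;
* Lemma 24 (= 7.9) → `rodgers_tao_truncEnergy_lower_bound`;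
* Corollary 25 (= 7.10) → `rodgers_tao_truncHamiltonian_bound`.

CITED, not restated: **Theorem 17 (= 7.2)** is the tree's named fact
`rodgers_tao_integrated_energy_bound` (`RodgersTaoEnergy.lean`; witness form, window
`Finset.Icc ⌈T log T/2⌉₊ ⌊3T log T⌋₊`, i.e. the v5 form `[0.5 T log T, 3T log T]_{ℤ*}` — FMP
prints the v4 form `[…]_ℤ`; discharged ex falso as `rodgers_tao_integrated_energy_bound_holds`,
`RodgersTaoEnergyProofs.lean`), consumed by the §8 files `RodgersTaoEnergyProofs.lean` /
`RodgersTaoEnergyV5Proofs.lean`; `E_{jk}` (58) = `interactionEnergy`, `H_{jk}` (57) =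
`hamiltonianInteraction`, `x_j` on `ℤ*` = `deBruijnZeroZ`, `[a,b]_{ℤ*}` = `zstarIcc`
(`RodgersTaoZeroDynamics.lean`); `log₊` = `logPlus`, `ξ_j` on `ℤ*` = `classicalLocationZ`,
`∼_T` = `Nearby` (`RodgersTaoNotation.lean`); `V` = `renormPotential`, `Ẽ` on positive indices =
`renormEnergy[On]` (`RodgersTaoEnergy.lean`). Remark 23 is prose (no declaration). The reductions
(65) ⇐ (68) and (68) ⇐ Prop. 22 + Cor. 25 (p. 42, p. 57) are proof steps, not numbered
statements, and are not typed.

§8 locator map (v4 ↔ v5 ↔ FMP; the tree's §8 files cite v4 / «(v5)» sectional numbers): v4 Prop.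
8.1 = v5 Prop. 26 = FMP Prop. 26 p. 57 «Energy bound at time zero» ↔ `rodgers_tao_energy_bound_zero`;
v5 Prop. 27 «Locating a good interval» (v5 only; absent from v4 and FMP) ↔ `GoodIntervalBound` /
`goodIntervalBound_of_integrated_energy_bound`; v4 Prop. 8.2 = FMP Prop. 27 p. 57 «Energy
propagation inequality» (UNCORRECTED `+ Õ(1)` form) ↔ `rodgers_tao_energy_propagation` (printed
proof withdrawn), corrected as v5 Prop. 28 (`+ Õ(1 + |I₋ − I₋⁰| + |I₊ − I₊⁰|)`, «`I⁰` as in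
Prop. 27»; footnote thanking O. Zeitouni) ↔ `EnergyPropagationV5` / `energyPropagationV5_of_neg`.

## Rendering conventions and divergences (rt/README §0.4, rt/REFEREE §6)

* Witness form: `Λ ↦ t₀` with `t₀ < 0`, `HasOnlyRealZeros (deBruijnH t₀)`; `Λ/2 ≤ t ≤ 0` ↦
  `t₀/2 ≤ t ≤ 0`, `Λ/4 ≤ t ≤ 0` ↦ `t₀/4 ≤ t ≤ 0` (as `RodgersTaoEnergy.lean`,
  `RodgersTaoEnergyV5.lean`). For such `t` one has `t > t₀ ≥ Λ`, so the `ℤ*`-zeros are the genuine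
  simple real zeros (`strictMono_deBruijnZeroZ`, `deBruijnH_deBruijnZeroZ`).
* «`T` large»: from (65) on the source works under «we may assume without loss of generality that
  `T` is large» (p. 42); every `T`-statement is typed `∃ T₁, ∀ T ≥ T₁` (for `T ≤ 1`, `ψ_T` is a
  junk value since `T log T ≤ 0`). `log³₊ T`, `log T` ↦ `Real.log T` for such `T` (comparable;
  absorbed in the constants / in `ε`), as in the tree's Thm. 17 / Prop. 26.
* `O(Y)`, `X ≪ Y` ↦ `∃ C, |X| ≤ C·Y`; `Õ(1)` ↦ `C · log T ^ A`; `O(log₊^{O(1)} Z)` ↦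
  `C · logPlus Z ^ A` (`A C : ℝ`, real powers); `o_{T→∞}(Y)` ↦ `∀ ε > 0, ∃ T₁, ∀ T ≥ T₁, |X| ≤ ε·Y`,
  with `T₁` independent of `t` (the decay rates in Lemma 19 / Prop. 22 are uniform in `t`: they
  come from (43)–(45), (50)–(52), (66) with absolute constants, and Cor. 25 uses them uniformly);
  «`δ(T) → 0` sufficiently slowly» ↦ `∃ δ₀ → 0` (a threshold rate) such that the claim holds for
  every positive `δ → 0` with `δ₀ ≤ δ` eventually; «`ε(j) → 0` as `|j| → ∞`» ↦ an explicit
  `∀ η > 0, ∃ J, ∀ j, J ≤ |j| → ε j ≤ η` with `ε > 0`.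
* «for almost every `Λ/2 ≤ t ≤ 0`» ↦ `∀ᵐ t ∂(volume.restrict (Icc (t₀/2) 0))`; «absolutely
  continuous» ↦ Mathlib's `AbsolutelyContinuousOnInterval _ (t₀/2) 0`; `∂ₜ H̃_T(t)` ↦
  `deriv (truncHamiltonian T) t` (meaningful a.e. by absolute continuity).
* Infinite sums over `j ≠ k ∈ ℤ*` / `j ∼_T k` are `tsum`s over the index types `zstarOffDiag` /
  `nearbyPairs T` TOGETHER WITH explicit `Summable` clauses wherever the source asserts absolute
  convergence / finiteness («`Ẽ_T` … is finite for almost every `t`» p. 42; «the sum here is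
  absolutely convergent» pp. 44, 43), so that no `tsum` in a fact carries a junk value; where the
  source's bound is trivially true for `Ẽ_T(t) = +∞` (Lemma 21, Lemma 24) the typed statement
  carries `Summable (truncEnergyTerm T t)` as a hypothesis.
* Lemma 16: the interval endpoints are integers `a ≤ b` (`zstarIcc a b`; the source allows real
  `I_±`, which changes `[I₋, I₊]_{ℤ*}` only through `⌈I₋⌉, ⌊I₊⌋` and `log₊(|I₋|+|I₊|)` by `O(1)`).
* Lemma 21, «similarly with `ξ_i`»: typed literally (witness form, with `+ Ẽ_T(t)` in the bound),
  although the `ξ`-sums involve neither `t` nor the zeros. POSSIBLE GAP IN PRINT (flagged to the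
  cell referee, not adjudicated here): the printed one-line proof of item (ii) («Using
  `log₊ T/|x_j − x_k| ≤ 1/|x_j − x_k|² + log²₊ T` we then obtain (ii)») sums the term
  `ψ_T(j)ψ_T(k) log²₊ T` over ALL pairs `j ≠ k`, which is `log²₊ T (Σ_j ψ_T(j))² ≍ T² log⁴ T`, not
  `O(T log³ T)`; and a direct count at an arithmetic-progression configuration
  (`x_k − x_j ≈ 4π(k − j)/log T`, cf. (45), (50)) gives `(log T) Σ_{j ≠ k} ψψ/|x_j − x_k| ≍ T log⁴ T`
  (harmonic sum over `|k − j| ≲ T log T`), i.e. a factor `≍ log T` above «moderately sized» when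
  `Ẽ_T(t) ≲ T log³ T`; the same count applies verbatim to the `ξ`-version, which is why NO `t`-free
  RH-FREE form `≤ C T log³ T` of (ii)-with-`ξ` is typed (it would be a false statement about the
  `ξ_j`). Item (ii) is used in the proof of Prop. 22 (for `X₄` and (83)). Since all §7 facts here
  are in witness form (antecedent refuted), no questionable statement enters the tree as an
  RH-FREE fact; what IS typed RH-FREE from this lemma are the two displays of its proof about
  `1/|ξ_j − ξ_k|²`, which follow from (44).
* Lemma 24: `m ≥ 1` (the source's «natural number»; `m = 0` is never used — Cor. 25 takes
  `m ≥ m₀` large — and would read «`H̃_T ≥ 0 ⇒ Ẽ_T ≫ δ T log³ T`», which the proof via (85)–(86)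
  does not give).
* Proposition 22 prints «the function `H_T` is absolutely continuous» (calligraphic, no tilde) —
  read `H̃_T`, as (76) and the proof («we conclude that `H̃_T` is absolutely continuous», p. 50).
* SIGN in the proof of Lemma 19 (p. 44): the display
  `H̃_{jk} = H_{jk} − log(1/|ξ_j − ξ_k|) − ((x_j − ξ_j) − (x_k − ξ_k))/(ξ_j − ξ_k)` holds with `+`
  in place of the last `−` (`L(r) = −log r + r − 1` for `r > 0`); the proved identity
  `renormHamiltonianZ_eq_hamiltonianInteraction_sub` has the correct sign (immaterial to the
  source's argument, which bounds the absolute value of that term).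

## References

* B. Rodgers, T. Tao, *The de Bruijn–Newman constant is non-negative*, Forum Math. Pi 8 (2020)
  e6, §7 pp. 39–57 (Lemma 16 – Cor. 25, (62)–(89)); §1.2 pp. 6–7 (notation, standing hypothesis);
  Remark 5 p. 8 = arXiv:1801.05914v4 §7 (Lemma 7.1 – Cor. 7.10), §1.2, Remark 2.2; arXiv v5
  (2021) l. 978–1437.
* A. Dobner, *A proof of Newman's conjecture for the extended Selberg class*, Acta Arith. 201
  (2021) 29–62 (the tree's route to `Λ ≥ 0`, `rodgers_tao_holds`, which refutes the antecedents).
-/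

noncomputable section

open Real Filter Set Topology MeasureTheory

namespace Literature.NumberTheory.LFunctions

/-! ## (62): the three regimes of `V` with explicit constants -/

/-- (62), small regime, lower bound: `1/(4x²) ≤ V(x)` for `0 < |x| ≤ 1/2`
(`V(x) = (|x| − 1)²(2|x| + 1)/x²` with `(|x| − 1)² ≥ 1/4`, `2|x| + 1 ≥ 1`).
[cite: RodgersTaoFMP2020, §7 p. 40 (62)] -/
theorem le_renormPotential_of_abs_le_half {x : ℝ} (hx : x ≠ 0) (h : |x| ≤ 1 / 2) :
    1 / (4 * x ^ 2) ≤ renormPotential x := by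
  rw [renormPotential_eq hx, div_le_div_iff₀ (by positivity) (by positivity), ← sq_abs x]
  have h0 : 0 < |x| := abs_pos.2 hx
  have h1 : 1 / 4 ≤ (|x| - 1) ^ 2 := by nlinarith
  have h2 : 1 ≤ 2 * |x| + 1 := by linarith
  have h3 : (0 : ℝ) ≤ |x| ^ 2 := sq_nonneg _
  nlinarith [mul_le_mul h1 h2 (by norm_num) (sq_nonneg _)]

/-- (62), small regime, upper bound: `V(x) ≤ 2/x²` for `0 < |x| ≤ 1/2`.
[cite: RodgersTaoFMP2020, §7 p. 40 (62)] -/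
theorem renormPotential_le_of_abs_le_half {x : ℝ} (hx : x ≠ 0) (h : |x| ≤ 1 / 2) :
    renormPotential x ≤ 2 / x ^ 2 := by
  rw [renormPotential_eq hx, div_le_div_iff₀ (by positivity) (by positivity), ← sq_abs x]
  have h0 : 0 < |x| := abs_pos.2 hx
  have h1 : (|x| - 1) ^ 2 ≤ 1 := by nlinarith
  have h2 : 2 * |x| + 1 ≤ 2 := by linarith
  nlinarith [mul_le_mul h1 h2 (by linarith) (by norm_num : (0:ℝ) ≤ 1), sq_nonneg (|x|)]

/-- (62), middle regime, upper bound: `V(x) ≤ 8 (|x| − 1)²` for `|x| ≥ 1/2` (the lower bound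
`(|x| − 1)² ≤ V(x)` for `0 < |x| ≤ 2` is the tree's `sq_sub_one_le_renormPotential`).
[cite: RodgersTaoFMP2020, §7 p. 40 (62)] -/
theorem renormPotential_le_eight_mul_sq {x : ℝ} (h : 1 / 2 ≤ |x|) :
    renormPotential x ≤ 8 * (|x| - 1) ^ 2 := by
  have hx : x ≠ 0 := abs_pos.1 (by linarith)
  rw [renormPotential_eq hx, div_le_iff₀ (by positivity), ← sq_abs x]
  have h1 : 2 * |x| + 1 ≤ 8 * |x| ^ 2 := by
    nlinarith [mul_nonneg (sub_nonneg.2 h) (by positivity : (0 : ℝ) ≤ 4 * |x| + 1)]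
  nlinarith [mul_le_mul_of_nonneg_left h1 (sq_nonneg (|x| - 1))]

/-- (62), large regime, upper bound: `V(x) ≤ 2|x|` for `|x| ≥ 2` (indeed
`V(x) = 2|x| − 3 + 1/x²`). [cite: RodgersTaoFMP2020, §7 p. 40 (62)] -/
theorem renormPotential_le_two_mul_abs {x : ℝ} (h : 2 ≤ |x|) : renormPotential x ≤ 2 * |x| := by
  have hx : x ≠ 0 := abs_pos.1 (by linarith)
  have h1 : 1 / x ^ 2 ≤ 1 := by
    rw [div_le_one (by positivity), ← sq_abs x]; nlinarith
  rw [renormPotential_eq_def]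
  linarith

/-- (62), large regime, lower bound: `|x|/2 ≤ V(x)` for `|x| ≥ 2` (from the tree's
`sub_one_le_renormPotential : |x| − 1 ≤ V(x)`). [cite: RodgersTaoFMP2020, §7 p. 40 (62)] -/
theorem abs_div_two_le_renormPotential {x : ℝ} (h : 2 ≤ |x|) : |x| / 2 ≤ renormPotential x := by
  have := sub_one_le_renormPotential h
  linarith

/-- The algebra behind (63): for `a, b ≠ 0` of the same sign,
`V(a/b)/b² = 1/a² − 1/b² + 2(a − b)/b³`. [cite: RodgersTaoFMP2020, §7 p. 40 (63)] -/
theorem renormPotential_div_div_sq {a b : ℝ} (ha : a ≠ 0) (hb : b ≠ 0) (hab : 0 < a / b) :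
    renormPotential (a / b) / b ^ 2 = 1 / a ^ 2 - 1 / b ^ 2 + 2 * (a - b) / b ^ 3 := by
  rw [renormPotential_eq_def, abs_of_pos hab]
  field_simp

/-! ## The renormalised energy on `ℤ*`: `Ẽ_{jk}` and `Ẽ^I` (p. 40) -/

/-- The renormalised interaction energy `Ẽ_{jk}(t) := V((x_k(t) − x_j(t))/(ξ_k − ξ_j))/|ξ_k − ξ_j|²`
for `j, k ∈ ℤ*` distinct (Rodgers–Tao 2020, §7, FMP p. 40), over the `ℤ*`-indexed zeros
`deBruijnZeroZ` and classical locations `classicalLocationZ`; it extends the tree's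
`ℕ`-indexed `renormEnergy` (`renormEnergyZ_natCast`). Junk: indices `0`, `j = k` (never used).
[cite: RodgersTaoFMP2020, §7 p. 40 (definition of Ẽ_jk)] -/
def renormEnergyZ (t : ℝ) (j k : ℤ) : ℝ :=
  renormPotential ((deBruijnZeroZ t k - deBruijnZeroZ t j) /
      (classicalLocationZ k - classicalLocationZ j)) /
    (classicalLocationZ k - classicalLocationZ j) ^ 2

/-- Unfolding lemma for `Ẽ_{jk}` on `ℤ*`. [cite: RodgersTaoFMP2020, §7 p. 40 (definition of Ẽ_jk)] -/
theorem renormEnergyZ_eq (t : ℝ) (j k : ℤ) :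
    renormEnergyZ t j k = renormPotential ((deBruijnZeroZ t k - deBruijnZeroZ t j) /
      (classicalLocationZ k - classicalLocationZ j)) / (classicalLocationZ k - classicalLocationZ j) ^ 2 :=
  rfl

/-- On positive natural-number indices `Ẽ_{jk}` on `ℤ*` is the tree's `renormEnergy`.
[cite: RodgersTaoFMP2020, §7 p. 40 (definition of Ẽ_jk)] -/
theorem renormEnergyZ_natCast (t : ℝ) {m n : ℕ} (hm : m ≠ 0) (hn : n ≠ 0) :
    renormEnergyZ t m n = renormEnergy t m n := by
  rw [renormEnergyZ, renormEnergy_eq, deBruijnZeroZ_natCast, deBruijnZeroZ_natCast,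
    classicalLocationZ_natCast hm, classicalLocationZ_natCast hn]

/-- `Ẽ_{jk} = Ẽ_{kj}` (`V` is even). [cite: RodgersTaoFMP2020, §7 p. 40 (definition of Ẽ_jk)] -/
theorem renormEnergyZ_comm (t : ℝ) (j k : ℤ) : renormEnergyZ t j k = renormEnergyZ t k j := by
  simp only [renormEnergyZ]
  have h1 : (deBruijnZeroZ t j - deBruijnZeroZ t k) / (classicalLocationZ j - classicalLocationZ k)
      = (deBruijnZeroZ t k - deBruijnZeroZ t j) / (classicalLocationZ k - classicalLocationZ j) := by
    rw [← neg_sub (deBruijnZeroZ t k), ← neg_sub (classicalLocationZ k), neg_div_neg_eq]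
  have h2 : (classicalLocationZ j - classicalLocationZ k) ^ 2 =
      (classicalLocationZ k - classicalLocationZ j) ^ 2 := by ring
  rw [h1, h2]

/-- `Ẽ_{jk}(t) ≥ 0` for distinct `j, k` when the zeros at time `t` are strictly increasing on `ℤ`
(in particular for every `t > Λ`), «clearly a non-negative quantity» (p. 40).
[cite: RodgersTaoFMP2020, §7 p. 40 (definition of Ẽ^I)] -/
theorem renormEnergyZ_nonneg_of_strictMono {t : ℝ} (hmono : StrictMono (deBruijnZeroZ t))
    {j k : ℤ} (hjk : j ≠ k) : 0 ≤ renormEnergyZ t j k := by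
  rw [renormEnergyZ_eq]
  refine div_nonneg (renormPotential_nonneg (div_ne_zero ?_ ?_)) (sq_nonneg _)
  · exact sub_ne_zero.2 fun h ↦ hjk (hmono.injective h).symm
  · exact classicalLocationZ_sub_ne_zero hjk

/-- **(63)**, PROVED: for `t > Λ` and distinct `j, k ∈ ℤ*`,
`Ẽ_{jk}(t) = E_{jk}(t) − 1/|ξ_k − ξ_j|² + 2((x_k(t) − ξ_k) − (x_j(t) − ξ_j))/(ξ_k − ξ_j)³`, where
`E_{jk}` (58) is `interactionEnergy` («we observe that», p. 40; the ratio `(x_k − x_j)/(ξ_k − ξ_j)`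
is positive since both sequences are strictly increasing). [cite: RodgersTaoFMP2020, §7 p. 40 (63)] -/
theorem renormEnergyZ_eq_interactionEnergy_sub {t : ℝ}
    (hΛ : ∃ t₁ : ℝ, t₁ < t ∧ HasOnlyRealZeros (deBruijnH t₁)) {j k : ℤ} (hjk : j ≠ k) :
    renormEnergyZ t j k = interactionEnergy t j k
      - 1 / (classicalLocationZ k - classicalLocationZ j) ^ 2
      + 2 * ((deBruijnZeroZ t k - classicalLocationZ k) - (deBruijnZeroZ t j - classicalLocationZ j))
          / (classicalLocationZ k - classicalLocationZ j) ^ 3 := by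
  have hx : deBruijnZeroZ t k - deBruijnZeroZ t j ≠ 0 := deBruijnZeroZ_sub_ne_zero hΛ hjk
  have hξ : classicalLocationZ k - classicalLocationZ j ≠ 0 := classicalLocationZ_sub_ne_zero hjk
  have hpos : 0 < (deBruijnZeroZ t k - deBruijnZeroZ t j) /
      (classicalLocationZ k - classicalLocationZ j) := by
    rcases lt_or_gt_of_ne hjk with h | h
    · exact div_pos (sub_pos.2 (strictMono_deBruijnZeroZ hΛ h))
        (sub_pos.2 (strictMono_classicalLocationZ h))
    · exact div_pos_of_neg_of_neg (sub_neg.2 (strictMono_deBruijnZeroZ hΛ h))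
        (sub_neg.2 (strictMono_classicalLocationZ h))
  rw [renormEnergyZ_eq, renormPotential_div_div_sq hx hξ hpos, interactionEnergy_eq]
  have : (deBruijnZeroZ t j - deBruijnZeroZ t k) ^ 2 = (deBruijnZeroZ t k - deBruijnZeroZ t j) ^ 2 := by
    ring
  rw [this]
  ring

/-- The renormalised energy `Ẽ^I(t) := Σ_{j,k ∈ I : j ≠ k} Ẽ_{jk}(t)` of a finite set `I ⊂ ℤ*`
(Rodgers–Tao 2020, §7, FMP p. 40, for discrete intervals `I ⊂ ℤ*`), the sum running over the
ordered pairs `I.offDiag`; for `I ⊂ ℕ ∖ {0}` it is the tree's `renormEnergyOn`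
(`renormEnergyOnZ_map_natCast`). [cite: RodgersTaoFMP2020, §7 p. 40 (definition of Ẽ^I)] -/
def renormEnergyOnZ (t : ℝ) (I : Finset ℤ) : ℝ :=
  ∑ p ∈ I.offDiag, renormEnergyZ t p.1 p.2

/-- Unfolding lemma for `Ẽ^I` on `ℤ*`. [cite: RodgersTaoFMP2020, §7 p. 40 (definition of Ẽ^I)] -/
theorem renormEnergyOnZ_eq (t : ℝ) (I : Finset ℤ) :
    renormEnergyOnZ t I = ∑ p ∈ I.offDiag, renormEnergyZ t p.1 p.2 := rfl

/-- For a finite set of positive natural numbers, `Ẽ^I` on `ℤ*` is the tree's `renormEnergyOn`.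
[cite: RodgersTaoFMP2020, §7 p. 40 (definition of Ẽ^I)] -/
theorem renormEnergyOnZ_map_natCast (t : ℝ) {I : Finset ℕ} (hI : 0 ∉ I) :
    renormEnergyOnZ t (I.map Nat.castEmbedding) = renormEnergyOn t I := by
  rw [renormEnergyOnZ_eq, renormEnergyOn_eq]
  symm
  refine Finset.sum_nbij' (fun q ↦ ((q.1 : ℤ), (q.2 : ℤ))) (fun p ↦ (p.1.toNat, p.2.toNat))
    ?_ ?_ ?_ ?_ ?_
  · rintro ⟨q1, q2⟩ hq
    simp only [Finset.mem_offDiag, Finset.mem_map, Nat.castEmbedding_apply] at hq ⊢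
    exact ⟨⟨q1, hq.1, rfl⟩, ⟨q2, hq.2.1, rfl⟩, by exact_mod_cast hq.2.2⟩
  · rintro ⟨p1, p2⟩ hp
    simp only [Finset.mem_offDiag, Finset.mem_map, Nat.castEmbedding_apply] at hp ⊢
    obtain ⟨⟨a, ha, rfl⟩, ⟨b, hb, rfl⟩, hne⟩ := hp
    simp only [Int.toNat_natCast]
    exact ⟨ha, hb, fun h ↦ hne (by rw [h])⟩
  · rintro ⟨q1, q2⟩ _
    simp
  · rintro ⟨p1, p2⟩ hp
    simp only [Finset.mem_offDiag, Finset.mem_map, Nat.castEmbedding_apply] at hp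
    obtain ⟨⟨a, ha, rfl⟩, ⟨b, hb, rfl⟩, hne⟩ := hp
    simp
  · rintro ⟨q1, q2⟩ hq
    simp only [Finset.mem_offDiag] at hq
    have h1 : q1 ≠ 0 := fun h ↦ hI (h ▸ hq.1)
    have h2 : q2 ≠ 0 := fun h ↦ hI (h ▸ hq.2.1)
    exact (renormEnergyZ_natCast t h1 h2).symm

/-- `Ẽ^I(t) ≥ 0` when the zeros at time `t` are strictly increasing on `ℤ` («clearly a
non-negative quantity», p. 40). [cite: RodgersTaoFMP2020, §7 p. 40 (definition of Ẽ^I)] -/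
theorem renormEnergyOnZ_nonneg_of_strictMono {t : ℝ} (hmono : StrictMono (deBruijnZeroZ t))
    (I : Finset ℤ) : 0 ≤ renormEnergyOnZ t I := by
  refine Finset.sum_nonneg fun p hp ↦ ?_
  rw [Finset.mem_offDiag] at hp
  exact renormEnergyZ_nonneg_of_strictMono hmono hp.2.2

/-- `Ẽ^I(t)` is «non-decreasing in `I`» (p. 40) when the zeros at time `t` are strictly increasing
on `ℤ`. [cite: RodgersTaoFMP2020, §7 p. 40 (definition of Ẽ^I)] -/
theorem renormEnergyOnZ_mono_of_strictMono {t : ℝ} (hmono : StrictMono (deBruijnZeroZ t))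
    {I J : Finset ℤ} (hIJ : I ⊆ J) : renormEnergyOnZ t I ≤ renormEnergyOnZ t J :=
  Finset.sum_le_sum_of_subset_of_nonneg (Finset.offDiag_mono hIJ) fun p hp _ ↦ by
    rw [Finset.mem_offDiag] at hp
    exact renormEnergyZ_nonneg_of_strictMono hmono hp.2.2

/-! ## (66) the weight `ψ_T`, (67) the truncated energy `Ẽ_T` -/

/-- The weight `ψ_T(j) := (1 + |j|/(T log T))^{−100}` on `ℤ*` (Rodgers–Tao 2020, §7, FMP p. 42,
display (66)), written `((1 + |j|/(T log T))^100)⁻¹`. Junk for `T log T ≤ 0` (the source has `T`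
large). [cite: RodgersTaoFMP2020, §7 p. 42 (66)] -/
def truncWeight (T : ℝ) (j : ℤ) : ℝ :=
  ((1 + |(j : ℝ)| / (T * Real.log T)) ^ 100)⁻¹

/-- Unfolding lemma for `ψ_T`. [cite: RodgersTaoFMP2020, §7 p. 42 (66)] -/
theorem truncWeight_eq (T : ℝ) (j : ℤ) :
    truncWeight T j = ((1 + |(j : ℝ)| / (T * Real.log T)) ^ 100)⁻¹ := rfl

/-- `ψ_T` is even in `j`. [cite: RodgersTaoFMP2020, §7 p. 42 (66)] -/
@[simp] theorem truncWeight_neg (T : ℝ) (j : ℤ) : truncWeight T (-j) = truncWeight T j := by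
  simp [truncWeight]

/-- `0 < ψ_T(j) ≤ 1` when `T log T > 0` («a smooth positive weight», p. 42).
[cite: RodgersTaoFMP2020, §7 p. 42 (66)] -/
theorem truncWeight_pos {T : ℝ} (hT : 0 < T * Real.log T) (j : ℤ) : 0 < truncWeight T j := by
  rw [truncWeight_eq]
  have : 0 < 1 + |(j : ℝ)| / (T * Real.log T) := by positivity
  positivity

/-- `ψ_T(j) ≤ 1` when `T log T > 0`. [cite: RodgersTaoFMP2020, §7 p. 42 (66)] -/
theorem truncWeight_le_one {T : ℝ} (hT : 0 < T * Real.log T) (j : ℤ) : truncWeight T j ≤ 1 := by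
  rw [truncWeight_eq]
  have h1 : 1 ≤ 1 + |(j : ℝ)| / (T * Real.log T) := by
    have : 0 ≤ |(j : ℝ)| / (T * Real.log T) := by positivity
    linarith
  exact inv_le_one_of_one_le₀ (one_le_pow₀ h1)

/-- The index type of ordered pairs of distinct elements of `ℤ*`: `{(j,k) : j, k ∈ ℤ*, j ≠ k}`
(the range «`j, k ∈ ℤ* : j ≠ k`» of (67) and of Lemmas 18, 21).
[cite: RodgersTaoFMP2020, §7 p. 42 (67)] -/
def zstarOffDiag : Set (ℤ × ℤ) :=
  {p : ℤ × ℤ | p.1 ≠ 0 ∧ p.2 ≠ 0 ∧ p.1 ≠ p.2}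

/-- Membership in `zstarOffDiag`. [cite: RodgersTaoFMP2020, §7 p. 42 (67)] -/
@[simp] theorem mem_zstarOffDiag {p : ℤ × ℤ} :
    p ∈ zstarOffDiag ↔ p.1 ≠ 0 ∧ p.2 ≠ 0 ∧ p.1 ≠ p.2 := Iff.rfl

/-- The summand `ψ_T(j) ψ_T(k) Ẽ_{jk}(t)` of (67) on the pairs `j ≠ k` in `ℤ*`.
[cite: RodgersTaoFMP2020, §7 p. 42 (67)] -/
def truncEnergyTerm (T t : ℝ) (p : zstarOffDiag) : ℝ :=
  truncWeight T p.1.1 * truncWeight T p.1.2 * renormEnergyZ t p.1.1 p.1.2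

/-- Unfolding lemma for the summand of (67). [cite: RodgersTaoFMP2020, §7 p. 42 (67)] -/
theorem truncEnergyTerm_eq (T t : ℝ) (p : zstarOffDiag) :
    truncEnergyTerm T t p = truncWeight T p.1.1 * truncWeight T p.1.2 * renormEnergyZ t p.1.1 p.1.2 :=
  rfl

/-- The smoothly truncated renormalised energy
`Ẽ_T(t) := Σ_{j,k ∈ ℤ* : j ≠ k} ψ_T(j) ψ_T(k) Ẽ_{jk}(t)` (Rodgers–Tao 2020, §7, FMP p. 42, display
(67)), as a `tsum` over `zstarOffDiag`. The source's `Ẽ_T(t) ∈ [0, +∞]` is «finite for almost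
every `Λ/2 ≤ t ≤ 0`»; the typed statements assert `Summable (truncEnergyTerm T t)` where finiteness
is meant (junk `0` otherwise). [cite: RodgersTaoFMP2020, §7 p. 42 (67)] -/
def truncEnergy (T t : ℝ) : ℝ :=
  ∑' p : zstarOffDiag, truncEnergyTerm T t p

/-- Unfolding lemma for `Ẽ_T`. [cite: RodgersTaoFMP2020, §7 p. 42 (67)] -/
theorem truncEnergy_eq (T t : ℝ) : truncEnergy T t = ∑' p : zstarOffDiag, truncEnergyTerm T t p :=
  rfl

/-- The summands of (67) are non-negative when `T log T > 0` and the zeros at time `t` are strictly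
increasing on `ℤ` («This is clearly non-negative», p. 42). [cite: RodgersTaoFMP2020, §7 p. 42 (67)] -/
theorem truncEnergyTerm_nonneg {T t : ℝ} (hT : 0 < T * Real.log T)
    (hmono : StrictMono (deBruijnZeroZ t)) (p : zstarOffDiag) : 0 ≤ truncEnergyTerm T t p :=
  mul_nonneg (mul_nonneg (truncWeight_pos hT _).le (truncWeight_pos hT _).le)
    (renormEnergyZ_nonneg_of_strictMono hmono p.2.2.2)

/-- `Ẽ_T(t) ≥ 0` when `T log T > 0` and the zeros at time `t` are strictly increasing on `ℤ`
(also in the junk case of a non-summable family, where the `tsum` is `0`).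
[cite: RodgersTaoFMP2020, §7 p. 42 (67)] -/
theorem truncEnergy_nonneg {T t : ℝ} (hT : 0 < T * Real.log T)
    (hmono : StrictMono (deBruijnZeroZ t)) : 0 ≤ truncEnergy T t :=
  tsum_nonneg (truncEnergyTerm_nonneg hT hmono)

/-! ## (70) the renormalised logarithm `L`, (71) `H̃_{jk}`, (69) the renormalised Hamiltonian `H̃_T` -/

/-- The renormalisation `L(x) := log(1/|x|) + |x| − 1` of `x ↦ log(1/|x|)` (Rodgers–Tao 2020, §7,
FMP p. 44, before (70)): «a convex non-negative function on `ℝ ∖ {0}` that vanishes precisely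
when `|x| = 1`». Junk: `L(0) = −1` (`log(1/0) = 0`; never used). [cite: RodgersTaoFMP2020, §7 p. 44 (70)] -/
def renormLog (x : ℝ) : ℝ :=
  Real.log (1 / |x|) + |x| - 1

/-- Unfolding lemma for `L`. [cite: RodgersTaoFMP2020, §7 p. 44 (70)] -/
theorem renormLog_eq_def (x : ℝ) : renormLog x = Real.log (1 / |x|) + |x| - 1 := rfl

/-- `L(x) = |x| − 1 − log |x|`. [cite: RodgersTaoFMP2020, §7 p. 44 (70)] -/
theorem renormLog_eq (x : ℝ) : renormLog x = |x| - 1 - Real.log |x| := by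
  rw [renormLog, one_div, Real.log_inv]; ring

/-- `L` is even. [cite: RodgersTaoFMP2020, §7 p. 44 (70)] -/
@[simp] theorem renormLog_neg (x : ℝ) : renormLog (-x) = renormLog x := by simp [renormLog]

/-- `L(|x|) = L(x)`. [cite: RodgersTaoFMP2020, §7 p. 44 (70)] -/
@[simp] theorem renormLog_abs (x : ℝ) : renormLog |x| = renormLog x := by simp [renormLog]

/-- `L(1) = 0`. [cite: RodgersTaoFMP2020, §7 p. 44 (70)] -/
@[simp] theorem renormLog_one : renormLog 1 = 0 := by simp [renormLog]

/-- `L ≥ 0` on `ℝ ∖ {0}` («non-negative», p. 44; `log u ≤ u − 1`).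
[cite: RodgersTaoFMP2020, §7 p. 44 (70)] -/
theorem renormLog_nonneg {x : ℝ} (hx : x ≠ 0) : 0 ≤ renormLog x := by
  rw [renormLog_eq]
  have := Real.log_le_sub_one_of_pos (abs_pos.2 hx)
  linarith

/-- `L(x) = 0 ↔ |x| = 1` on `ℝ ∖ {0}` («vanishes precisely when `|x| = 1`», p. 44).
[cite: RodgersTaoFMP2020, §7 p. 44 (70)] -/
theorem renormLog_eq_zero_iff {x : ℝ} (hx : x ≠ 0) : renormLog x = 0 ↔ |x| = 1 := by
  refine ⟨fun h ↦ ?_, fun h ↦ by rw [← renormLog_abs, h, renormLog_one]⟩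
  by_contra hne
  have := Real.log_lt_sub_one_of_pos (abs_pos.2 hx) hne
  rw [renormLog_eq] at h
  linarith

/-- (70), small regime, upper bound: `L(x) ≤ log₊(1/|x|)` for `|x| ≤ 1/2` (indeed for
`|x| ≤ 1`: `L(x) ≤ log(1/|x|) ≤ log(2 + 1/|x|)`). [cite: RodgersTaoFMP2020, §7 p. 44 (70)] -/
theorem renormLog_le_logPlus_inv {x : ℝ} (h : |x| ≤ 1) :
    renormLog x ≤ logPlus (1 / |x|) := by
  rw [renormLog_eq_def]
  have h1 : Real.log (1 / |x|) ≤ logPlus (1 / |x|) := log_le_logPlus _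
  linarith

/-- (70), middle regime, upper bound: `L(x) ≤ 2 (|x| − 1)²` for `|x| ≥ 1/2`
(`L(u) = u − 1 − log u ≤ (u − 1) − (1 − 1/u) = (u − 1)²/u`).
[cite: RodgersTaoFMP2020, §7 p. 44 (70)] -/
theorem renormLog_le_two_mul_sq {x : ℝ} (h : 1 / 2 ≤ |x|) : renormLog x ≤ 2 * (|x| - 1) ^ 2 := by
  have h0 : 0 < |x| := by linarith
  rw [renormLog_eq]
  -- `1 - 1/u ≤ log u`, from `log (1/u) ≤ 1/u - 1`
  have h1 : 1 - 1 / |x| ≤ Real.log |x| := by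
    have := Real.log_le_sub_one_of_pos (one_div_pos.2 h0)
    rw [one_div, Real.log_inv] at this
    rw [one_div]; linarith
  have h2 : |x| - 1 - Real.log |x| ≤ (|x| - 1) ^ 2 / |x| := by
    rw [le_div_iff₀ h0]
    have h3 : (1 - 1 / |x|) * |x| = |x| - 1 := by field_simp
    nlinarith [mul_le_mul_of_nonneg_right h1 h0.le]
  have h4 : (|x| - 1) ^ 2 / |x| ≤ 2 * (|x| - 1) ^ 2 := by
    rw [div_le_iff₀ h0]; nlinarith [sq_nonneg (|x| - 1)]
  linarith

/-- (70), large regime, upper bound: `L(x) ≤ |x|` for `|x| ≥ 2` (indeed for `|x| ≥ 1`, as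
`log |x| ≥ 0`). [cite: RodgersTaoFMP2020, §7 p. 44 (70)] -/
theorem renormLog_le_abs {x : ℝ} (h : 1 ≤ |x|) : renormLog x ≤ |x| := by
  rw [renormLog_eq]
  have := Real.log_nonneg h
  linarith

/-- (70), large regime, lower bound: `|x|/16 ≤ L(x)` for `|x| ≥ 2`
(`log u = 2 log √u ≤ 2(√u − 1)`, so `L(u) ≥ (√u − 1)² ≥ u/16` for `u ≥ 2`).
[cite: RodgersTaoFMP2020, §7 p. 44 (70)] -/
theorem abs_div_sixteen_le_renormLog {x : ℝ} (h : 2 ≤ |x|) : |x| / 16 ≤ renormLog x := by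
  rw [renormLog_eq]
  set u := |x| with hu
  have hu0 : 0 < u := by linarith
  set s := Real.sqrt u with hs
  have hs0 : 0 < s := Real.sqrt_pos.2 hu0
  have hsu : s ^ 2 = u := Real.sq_sqrt hu0.le
  have hlog : Real.log u ≤ 2 * (s - 1) := by
    have h1 : Real.log u = 2 * Real.log s := by
      rw [← hsu, Real.log_pow]; norm_num
    rw [h1]
    linarith [Real.log_le_sub_one_of_pos hs0]
  have hs141 : (1.41 : ℝ) ≤ s := by
    rw [hs]
    exact Real.le_sqrt_of_sq_le (by nlinarith)
  nlinarith [sq_nonneg (s - 1.41), hsu, hs141]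

/-- The normalised Hamiltonian interaction `H̃_{jk}(t) := L((x_j(t) − x_k(t))/(ξ_j − ξ_k))` for
distinct `j, k ∈ ℤ*` (Rodgers–Tao 2020, §7, FMP p. 44, display (71)): «symmetric in `j, k` and
non-negative, vanishing precisely when `x_k(t) − x_j(t) = ξ_k − ξ_j`». Junk: indices `0`, `j = k`.
[cite: RodgersTaoFMP2020, §7 p. 44 (71)] -/
def renormHamiltonianZ (t : ℝ) (j k : ℤ) : ℝ :=
  renormLog ((deBruijnZeroZ t j - deBruijnZeroZ t k) / (classicalLocationZ j - classicalLocationZ k))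

/-- Unfolding lemma for `H̃_{jk}`. [cite: RodgersTaoFMP2020, §7 p. 44 (71)] -/
theorem renormHamiltonianZ_eq (t : ℝ) (j k : ℤ) :
    renormHamiltonianZ t j k =
      renormLog ((deBruijnZeroZ t j - deBruijnZeroZ t k) / (classicalLocationZ j - classicalLocationZ k)) :=
  rfl

/-- `H̃_{jk} = H̃_{kj}` («symmetric in `j, k`», p. 44). [cite: RodgersTaoFMP2020, §7 p. 44 (71)] -/
theorem renormHamiltonianZ_comm (t : ℝ) (j k : ℤ) :
    renormHamiltonianZ t j k = renormHamiltonianZ t k j := by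
  simp only [renormHamiltonianZ]
  rw [← neg_sub (deBruijnZeroZ t k), ← neg_sub (classicalLocationZ k), neg_div_neg_eq]

/-- `H̃_{jk}(t) ≥ 0` for distinct `j, k` when the zeros at time `t` are strictly increasing on `ℤ`
(«non-negative», p. 44). [cite: RodgersTaoFMP2020, §7 p. 44 (71)] -/
theorem renormHamiltonianZ_nonneg_of_strictMono {t : ℝ} (hmono : StrictMono (deBruijnZeroZ t))
    {j k : ℤ} (hjk : j ≠ k) : 0 ≤ renormHamiltonianZ t j k := by
  rw [renormHamiltonianZ_eq]
  refine renormLog_nonneg (div_ne_zero ?_ ?_)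
  · exact sub_ne_zero.2 fun h ↦ hjk (hmono.injective h)
  · exact classicalLocationZ_sub_ne_zero (Ne.symm hjk)

/-- For `t > Λ` and distinct `j, k ∈ ℤ*`: `H̃_{jk}(t) = 0 ↔ x_k(t) − x_j(t) = ξ_k − ξ_j`
(«vanishing precisely when `x_k(t) − x_j(t) = ξ_k − ξ_j`», p. 44; the ratio is positive, so
`|r| = 1 ↔ r = 1`). [cite: RodgersTaoFMP2020, §7 p. 44 (71)] -/
theorem renormHamiltonianZ_eq_zero_iff {t : ℝ}
    (hΛ : ∃ t₁ : ℝ, t₁ < t ∧ HasOnlyRealZeros (deBruijnH t₁)) {j k : ℤ} (hjk : j ≠ k) :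
    renormHamiltonianZ t j k = 0 ↔
      deBruijnZeroZ t k - deBruijnZeroZ t j = classicalLocationZ k - classicalLocationZ j := by
  have hx : deBruijnZeroZ t j - deBruijnZeroZ t k ≠ 0 := deBruijnZeroZ_sub_ne_zero hΛ (Ne.symm hjk)
  have hξ : classicalLocationZ j - classicalLocationZ k ≠ 0 := classicalLocationZ_sub_ne_zero (Ne.symm hjk)
  have hpos : 0 < (deBruijnZeroZ t j - deBruijnZeroZ t k) /
      (classicalLocationZ j - classicalLocationZ k) := by
    rcases lt_or_gt_of_ne hjk with h | h
    · exact div_pos_of_neg_of_neg (sub_neg.2 (strictMono_deBruijnZeroZ hΛ h))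
        (sub_neg.2 (strictMono_classicalLocationZ h))
    · exact div_pos (sub_pos.2 (strictMono_deBruijnZeroZ hΛ h))
        (sub_pos.2 (strictMono_classicalLocationZ h))
  rw [renormHamiltonianZ_eq, renormLog_eq_zero_iff (div_ne_zero hx hξ), abs_of_pos hpos,
    div_eq_one_iff_eq hξ]
  constructor <;> intro h <;> linarith

/-- The identity of the proof of Lemma 19 (FMP p. 44), PROVED with the correct sign: for `t > Λ`
and distinct `j, k ∈ ℤ*`,
`H̃_{jk}(t) = H_{jk}(t) − log(1/|ξ_j − ξ_k|) + ((x_j(t) − ξ_j) − (x_k(t) − ξ_k))/(ξ_j − ξ_k)`, where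
`H_{jk}` (57) is `hamiltonianInteraction`. Divergence: the source prints `−` before the last
term; since `L(r) = −log r + (r − 1)` for the positive ratio `r = (x_j − x_k)/(ξ_j − ξ_k)`, the
correct sign is `+` (the source only uses the absolute value of this term).
[cite: RodgersTaoFMP2020, Lemma 19 p. 44 (proof, first display)] -/
theorem renormHamiltonianZ_eq_hamiltonianInteraction_sub {t : ℝ}
    (hΛ : ∃ t₁ : ℝ, t₁ < t ∧ HasOnlyRealZeros (deBruijnH t₁)) {j k : ℤ} (hjk : j ≠ k) :
    renormHamiltonianZ t j k = hamiltonianInteraction t j k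
      - Real.log (1 / |classicalLocationZ j - classicalLocationZ k|)
      + ((deBruijnZeroZ t j - classicalLocationZ j) - (deBruijnZeroZ t k - classicalLocationZ k))
          / (classicalLocationZ j - classicalLocationZ k) := by
  have hx : deBruijnZeroZ t j - deBruijnZeroZ t k ≠ 0 := deBruijnZeroZ_sub_ne_zero hΛ (Ne.symm hjk)
  have hξ : classicalLocationZ j - classicalLocationZ k ≠ 0 := classicalLocationZ_sub_ne_zero (Ne.symm hjk)
  have hpos : 0 < (deBruijnZeroZ t j - deBruijnZeroZ t k) /
      (classicalLocationZ j - classicalLocationZ k) := by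
    rcases lt_or_gt_of_ne hjk with h | h
    · exact div_pos_of_neg_of_neg (sub_neg.2 (strictMono_deBruijnZeroZ hΛ h))
        (sub_neg.2 (strictMono_classicalLocationZ h))
    · exact div_pos (sub_pos.2 (strictMono_deBruijnZeroZ hΛ h))
        (sub_pos.2 (strictMono_classicalLocationZ h))
  rw [renormHamiltonianZ_eq, renormLog_eq_def, hamiltonianInteraction_eq, abs_of_pos hpos]
  simp only [one_div, Real.log_inv]
  rw [Real.log_div hx hξ, Real.log_abs, Real.log_abs]
  field_simp
  ring

/-- The index type of nearby ordered pairs in `ℤ*`: `{(j,k) : j, k ∈ ℤ*, j ∼_T k}` (the range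
«`j, k ∈ ℤ* : j ∼_T k`» of (69) and of Lemma 19). [cite: RodgersTaoFMP2020, §7 p. 43 (69)] -/
def nearbyPairs (T : ℝ) : Set (ℤ × ℤ) :=
  {p : ℤ × ℤ | p.1 ≠ 0 ∧ p.2 ≠ 0 ∧ Nearby T p.1 p.2}

/-- Membership in `nearbyPairs T`. [cite: RodgersTaoFMP2020, §7 p. 43 (69)] -/
@[simp] theorem mem_nearbyPairs {T : ℝ} {p : ℤ × ℤ} :
    p ∈ nearbyPairs T ↔ p.1 ≠ 0 ∧ p.2 ≠ 0 ∧ Nearby T p.1 p.2 := Iff.rfl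

/-- Nearby pairs are off-diagonal pairs. [cite: RodgersTaoFMP2020, §7 p. 43 (69)] -/
theorem nearbyPairs_subset_zstarOffDiag (T : ℝ) : nearbyPairs T ⊆ zstarOffDiag :=
  fun _ hp ↦ ⟨hp.1, hp.2.1, hp.2.2.ne⟩

/-- The summand `ψ_T(j) ψ_T(k) (H_{jk}(t) − log(1/|ξ_j − ξ_k|))` of (69) on the nearby pairs,
`H_{jk}` (57) being `hamiltonianInteraction`. [cite: RodgersTaoFMP2020, §7 p. 43 (69)] -/
def truncHamiltonianTerm (T t : ℝ) (p : nearbyPairs T) : ℝ :=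
  truncWeight T p.1.1 * truncWeight T p.1.2 *
    (hamiltonianInteraction t p.1.1 p.1.2 -
      Real.log (1 / |classicalLocationZ p.1.1 - classicalLocationZ p.1.2|))

/-- Unfolding lemma for the summand of (69). [cite: RodgersTaoFMP2020, §7 p. 43 (69)] -/
theorem truncHamiltonianTerm_eq (T t : ℝ) (p : nearbyPairs T) :
    truncHamiltonianTerm T t p = truncWeight T p.1.1 * truncWeight T p.1.2 *
      (hamiltonianInteraction t p.1.1 p.1.2 -
        Real.log (1 / |classicalLocationZ p.1.1 - classicalLocationZ p.1.2|)) :=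
  rfl

/-- The smoothly truncated renormalised Hamiltonian
`H̃_T(t) := Σ_{j,k ∈ ℤ* : j ∼_T k} ψ_T(j) ψ_T(k) (H_{jk}(t) − log(1/|ξ_j − ξ_k|))` (Rodgers–Tao 2020,
§7, FMP p. 43, display (69)), as a `tsum` over `nearbyPairs T` («the sum here is absolutely
convergent for every `Λ/2 ≤ t ≤ 0`», p. 44 — asserted in the facts, junk `0` otherwise). For fixed
`T` it is the function `t ↦ H̃_T(t)` whose absolute continuity and a.e. derivative Prop. 22
concerns. [cite: RodgersTaoFMP2020, §7 p. 43 (69)] -/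
def truncHamiltonian (T t : ℝ) : ℝ :=
  ∑' p : nearbyPairs T, truncHamiltonianTerm T t p

/-- Unfolding lemma for `H̃_T`. [cite: RodgersTaoFMP2020, §7 p. 43 (69)] -/
theorem truncHamiltonian_eq (T t : ℝ) :
    truncHamiltonian T t = ∑' p : nearbyPairs T, truncHamiltonianTerm T t p := rfl

/-! ## «moderately sized» and «negligible» quantities (p. 47) -/

/-- «We call a (time-dependent) quantity *moderately sized* if it is of the form
`O(T log³₊ T + Ẽ_T(t))`» (Rodgers–Tao 2020, §7, FMP p. 47), for a quantity given as a series
`Σ_p F T t p` over the pairs `j ≠ k` in `ℤ*`, in the witness `t₀` of `Λ < 0`: there are `C`, `T₁`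
such that for all `T ≥ T₁` and `t₀/2 ≤ t ≤ 0` at which `Ẽ_T(t)` is finite, the series is summable
and `|Σ_p F T t p| ≤ C (T log³ T + Ẽ_T(t))`. [cite: RodgersTaoFMP2020, §7 p. 47 (before Lemma 21)] -/
def IsModeratelySized (t₀ : ℝ) (F : ℝ → ℝ → zstarOffDiag → ℝ) : Prop :=
  ∃ C T₁ : ℝ, ∀ T : ℝ, T₁ ≤ T → ∀ t : ℝ, t₀ / 2 ≤ t → t ≤ 0 →
    Summable (truncEnergyTerm T t) →
      Summable (F T t) ∧ |∑' p, F T t p| ≤ C * (T * Real.log T ^ 3 + truncEnergy T t)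

/-- «… and *negligible* if it is of the form `o_{T→∞}(T log³₊ T + Ẽ_T(t))`» (Rodgers–Tao 2020, §7,
FMP p. 47), same rendering with `∀ ε > 0, ∃ T₁` in place of `∃ C T₁` (decay rate uniform in `t`).
[cite: RodgersTaoFMP2020, §7 p. 47 (before Lemma 21)] -/
def IsNegligible (t₀ : ℝ) (F : ℝ → ℝ → zstarOffDiag → ℝ) : Prop :=
  ∀ ε : ℝ, 0 < ε → ∃ T₁ : ℝ, ∀ T : ℝ, T₁ ≤ T → ∀ t : ℝ, t₀ / 2 ≤ t → t ≤ 0 →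
    Summable (truncEnergyTerm T t) →
      Summable (F T t) ∧ |∑' p, F T t p| ≤ ε * (T * Real.log T ^ 3 + truncEnergy T t)

/-- A moderately sized quantity times a negligible scalar factor: if `F` is moderately sized then
`c(T) • F` is negligible for any `c(T) → 0` — not needed below; we only record that «negligible»
implies «moderately sized». [cite: RodgersTaoFMP2020, §7 p. 47 (before Lemma 21)] -/
theorem IsNegligible.isModeratelySized {t₀ : ℝ} {F : ℝ → ℝ → zstarOffDiag → ℝ}
    (h : IsNegligible t₀ F) : IsModeratelySized t₀ F := by
  obtain ⟨T₁, hT₁⟩ := h 1 one_pos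
  exact ⟨1, T₁, fun T hT t ht ht' hs ↦ hT₁ T hT t ht ht' hs⟩

end Literature.NumberTheory.LFunctions

/-! ## Named facts: Lemma 16 – Corollary 25 (witness form; VACUOUS-AS-PRINTED / EX-FALSO class) -/

namespace Literature.NumberTheory.LFunctions

/-- VACUOUS-AS-PRINTED (Λ ≥ 0) / EX-FALSO class — NAMED FACT. Rodgers–Tao 2020, **Lemma 16**
(= arXiv v4 Lemma 7.1; FMP p. 41): «If `I = [I₋, I₊]_{ℤ*}` is a discrete interval and
`Λ/2 ≤ t ≤ 0`, then `Ẽ^I(t) = (Σ_{j,k ∈ I : j ≠ k} E_{jk}(t) − 1/|ξ_k − ξ_j|²) + O(log₊^{O(1)}(|I₋| + |I₊|))`.»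
Typed (witness form, `Λ ↦ t₀`): for every `t₀ < 0` with `H_{t₀}` real-rooted there are `A, C`
such that for all `t₀/2 ≤ t ≤ 0` and all integers `a, b`,
`|Ẽ^{[a,b]_{ℤ*}}(t) − Σ_{(j,k) ∈ [a,b]_{ℤ*}², j ≠ k} (E_{jk}(t) − 1/(ξ_k − ξ_j)²)| ≤ C · log₊(|a| + |b|)^A`.
Typed range: printed `Λ/2 ≤ t ≤ 0` under `Λ < 0`; the antecedent is refuted by `rodgers_tao_holds`
(README §0.4, Remark 5). Divergence: integer endpoints (see module docstring); `O`-constants may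
depend on the witness `t₀` (on `Λ` in the source). Inputs of the printed proof: (63), (50), (44),
(45). Users take `(h : rodgers_tao_renormEnergyOn_expansion)`.
[cite: RodgersTaoFMP2020, Lemma 16 p. 41 (= arXiv:1801.05914v4 Lemma 7.1)] -/
def rodgers_tao_renormEnergyOn_expansion : Prop :=
  ∀ t₀ : ℝ, t₀ < 0 → HasOnlyRealZeros (deBruijnH t₀) →
    ∃ A C : ℝ, ∀ t : ℝ, t₀ / 2 ≤ t → t ≤ 0 → ∀ a b : ℤ,
      |renormEnergyOnZ t (zstarIcc a b) -
          ∑ p ∈ (zstarIcc a b).offDiag,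
            (interactionEnergy t p.1 p.2 - 1 / (classicalLocationZ p.2 - classicalLocationZ p.1) ^ 2)|
        ≤ C * logPlus (|(a : ℝ)| + |(b : ℝ)|) ^ A

/-- VACUOUS-AS-PRINTED (Λ ≥ 0) / EX-FALSO class — NAMED FACT. Rodgers–Tao 2020, **Lemma 18**
(= arXiv v4 Lemma 7.3; FMP p. 42): «For almost every `Λ/2 ≤ t ≤ 0`, one has
`Ẽ_T(t) = (Σ_{j,k ∈ ℤ* : j ≠ k} ψ_T(j)ψ_T(k)(E_{jk}(t) − 1/|ξ_k − ξ_j|²)) + Õ(1)`», `T` being large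
(p. 42) and, per the proof, both `Ẽ_T(t)` and the series `Σ ψψ(E_{jk} + 1/|ξ_k − ξ_j|² + ⋯)` being
finite / absolutely convergent for almost every `t` (Prop. 15, (66), Fubini). Typed (witness
form): for every `t₀ < 0` with `H_{t₀}` real-rooted there are `A, C, T₁` such that for all
`T ≥ T₁`, for a.e. `t ∈ [t₀/2, 0]`: `Ẽ_T(t)` is summable, the displayed series is summable, and
`|Ẽ_T(t) − Σ'…| ≤ C log^A T` (`Õ(1)`). Typed range / EX-FALSO: as Lemma 16. Divergence: none
otherwise. Users take `(h : rodgers_tao_truncEnergy_expansion)`.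
[cite: RodgersTaoFMP2020, Lemma 18 p. 42 (= arXiv:1801.05914v4 Lemma 7.3)] -/
def rodgers_tao_truncEnergy_expansion : Prop :=
  ∀ t₀ : ℝ, t₀ < 0 → HasOnlyRealZeros (deBruijnH t₀) →
    ∃ A C T₁ : ℝ, ∀ T : ℝ, T₁ ≤ T →
      ∀ᵐ t ∂(volume.restrict (Icc (t₀ / 2) 0)),
        Summable (truncEnergyTerm T t) ∧
        Summable (fun p : zstarOffDiag ↦ truncWeight T p.1.1 * truncWeight T p.1.2 *
          (interactionEnergy t p.1.1 p.1.2 -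
            1 / (classicalLocationZ p.1.2 - classicalLocationZ p.1.1) ^ 2)) ∧
        |truncEnergy T t - ∑' p : zstarOffDiag, truncWeight T p.1.1 * truncWeight T p.1.2 *
            (interactionEnergy t p.1.1 p.1.2 -
              1 / (classicalLocationZ p.1.2 - classicalLocationZ p.1.1) ^ 2)|
          ≤ C * Real.log T ^ A

/-- VACUOUS-AS-PRINTED (Λ ≥ 0) / EX-FALSO class — NAMED FACT. Rodgers–Tao 2020, **Lemma 19**
(= arXiv v4 Lemma 7.4; FMP p. 44): «For every `Λ/2 ≤ t ≤ 0`, one has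
`H̃_T(t) = Σ_{j,k ∈ ℤ* : j ∼_T k} ψ_T(j)ψ_T(k) H̃_{jk}(t) + o_{T→∞}(T log³₊ T)`», with (p. 44) «the sum
[(69)] is absolutely convergent for every `Λ/2 ≤ t ≤ 0`» and (proof) the difference series
absolutely convergent. Typed (witness form): for every `t₀ < 0` with `H_{t₀}` real-rooted and every
`ε > 0` there is `T₁` such that for all `T ≥ T₁` and all `t₀/2 ≤ t ≤ 0`: the series (69) and
`Σ_{j ∼_T k} ψψ H̃_{jk}(t)` are summable and differ by at most `ε T log³ T`. Typed range / EX-FALSO: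
as Lemma 16; decay rate uniform in `t` (module docstring). Users take
`(h : rodgers_tao_truncHamiltonian_expansion)`.
[cite: RodgersTaoFMP2020, Lemma 19 p. 44 (= arXiv:1801.05914v4 Lemma 7.4)] -/
def rodgers_tao_truncHamiltonian_expansion : Prop :=
  ∀ t₀ : ℝ, t₀ < 0 → HasOnlyRealZeros (deBruijnH t₀) →
    ∀ ε : ℝ, 0 < ε → ∃ T₁ : ℝ, ∀ T : ℝ, T₁ ≤ T → ∀ t : ℝ, t₀ / 2 ≤ t → t ≤ 0 →
      Summable (truncHamiltonianTerm T t) ∧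
      Summable (fun p : nearbyPairs T ↦
        truncWeight T p.1.1 * truncWeight T p.1.2 * renormHamiltonianZ t p.1.1 p.1.2) ∧
      |truncHamiltonian T t - ∑' p : nearbyPairs T,
          truncWeight T p.1.1 * truncWeight T p.1.2 * renormHamiltonianZ t p.1.1 p.1.2|
        ≤ ε * (T * Real.log T ^ 3)

/-- VACUOUS-AS-PRINTED (Λ ≥ 0) / EX-FALSO class — NAMED FACT. Rodgers–Tao 2020, **Lemma 20**
(Long-range decay of `H̃_{jk}`; = arXiv v4 Lemma 7.5; FMP p. 45): «Let `j, k` be distinct elements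
of `ℤ*`, and let `t` be in the range `Λ/2 ≤ t ≤ 0`. There exists a quantity `ε(j)` that goes to
zero as `|j| → ∞`, such that if `|k − j| ≥ ε(j)⁻¹ log²₊ ξ_j`, then
`H̃_{jk}(t) ≪ log⁴₊(|j|+|k|)/|k − j|²`, and if `ε(j) log²₊ ξ_j ≤ |k − j| ≤ ε(j)⁻¹ log²₊ ξ_j`, one has
the refinement `H̃_{jk}(t) ≪ ε(j)² log⁴₊ j/|k − j|²`. Finally, in the remaining region
`|k − j| < ε(j) log²₊ ξ_j`, one has the crude bound `H̃_{jk}(t) ≪ (log²₊ j) log₊ log₊ j`.» Typed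
(witness form): for every `t₀ < 0` with `H_{t₀}` real-rooted there are a positive function
`ε : ℤ → ℝ` with `ε(j) → 0` as `|j| → ∞` (explicit `∀ η > 0 ∃ J ∀ |j| ≥ J, ε j ≤ η`) and an
absolute `C` such that the three bounds hold for all `t₀/2 ≤ t ≤ 0` and distinct `j, k ∈ ℤ*`.
Typed range / EX-FALSO: as Lemma 16; inputs of the printed proof: (50), (52), (44), (45), (70),
Prop. 13. Divergence: none (`≪` constants absolute, `ε` independent of `t`, as printed).
Users take `(h : rodgers_tao_renormHamiltonian_decay)`.
[cite: RodgersTaoFMP2020, Lemma 20 p. 45 (= arXiv:1801.05914v4 Lemma 7.5)] -/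
def rodgers_tao_renormHamiltonian_decay : Prop :=
  ∀ t₀ : ℝ, t₀ < 0 → HasOnlyRealZeros (deBruijnH t₀) →
    ∃ ε : ℤ → ℝ, (∀ j, 0 < ε j) ∧
      (∀ η : ℝ, 0 < η → ∃ J : ℝ, ∀ j : ℤ, J ≤ |(j : ℝ)| → ε j ≤ η) ∧
      ∃ C : ℝ, ∀ t : ℝ, t₀ / 2 ≤ t → t ≤ 0 → ∀ j k : ℤ, j ≠ 0 → k ≠ 0 → j ≠ k →
        ((ε j)⁻¹ * logPlus (classicalLocationZ j) ^ 2 ≤ |(k : ℝ) - j| →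
          renormHamiltonianZ t j k ≤
            C * logPlus (|(j : ℝ)| + |(k : ℝ)|) ^ 4 / ((k : ℝ) - j) ^ 2) ∧
        (ε j * logPlus (classicalLocationZ j) ^ 2 ≤ |(k : ℝ) - j| →
          |(k : ℝ) - j| ≤ (ε j)⁻¹ * logPlus (classicalLocationZ j) ^ 2 →
          renormHamiltonianZ t j k ≤ C * (ε j) ^ 2 * logPlus j ^ 4 / ((k : ℝ) - j) ^ 2) ∧
        (|(k : ℝ) - j| < ε j * logPlus (classicalLocationZ j) ^ 2 →
          renormHamiltonianZ t j k ≤ C * logPlus j ^ 2 * logPlus (logPlus j))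

/-- VACUOUS-AS-PRINTED (Λ ≥ 0) / EX-FALSO class — NAMED FACT. Rodgers–Tao 2020, **Lemma 21**
(= arXiv v4 Lemma 7.6; FMP p. 47), items (i)–(iv) for the zeros `x_i(t)`: «Let `t` be in the range
`Λ/2 ≤ t ≤ 0`. (i) The quantity `Σ_{j,k ∈ ℤ* : j ≠ k} ψ_T(j)ψ_T(k)/|x_j(t) − x_k(t)|²` is moderately
sized. (ii) The quantity `(log₊ T) Σ_{j ≠ k} ψ_T(j)ψ_T(k)/|x_j(t) − x_k(t)|` is moderately sized.
(iii) For any absolute constants `C, c > 0`, the expression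
`(log^C₊ T) Σ_{|j|,|k| ≤ T^{1−c}} ψ_T(j)ψ_T(k)/|x_j(t) − x_k(t)|` is negligible. (iv) For any absolute
constants `C, c > 0`, the expression `(log^C₊ T) Σ_{|j|,|k| ≥ T^{1+c}} ψ_T(j)ψ_T(k)/|x_j(t) − x_k(t)|`
is negligible.» Typed (witness form, with `IsModeratelySized` / `IsNegligible`, i.e.
`O`/`o(T log³ T + Ẽ_T(t))` for `T` large and `t₀/2 ≤ t ≤ 0` with `Ẽ_T(t)` finite; in (i)
`1/|x_j − x_k|² = E_{jk}` is the tree's `interactionEnergy`; the restricted sums of (iii), (iv) are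
series with indicator). Typed range / EX-FALSO: as Lemma 16; `log₊ T ↦ log T` (`T` large). The «similarly with `ξ_i`» clause is `rodgers_tao_moderatelySized_xi`. Users take
`(h : rodgers_tao_moderatelySized)`.
[cite: RodgersTaoFMP2020, Lemma 21 p. 47 (= arXiv:1801.05914v4 Lemma 7.6)] -/
def rodgers_tao_moderatelySized : Prop :=
  ∀ t₀ : ℝ, t₀ < 0 → HasOnlyRealZeros (deBruijnH t₀) →
    IsModeratelySized t₀ (fun T t p ↦
      truncWeight T p.1.1 * truncWeight T p.1.2 * interactionEnergy t p.1.1 p.1.2) ∧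
    IsModeratelySized t₀ (fun T t p ↦ Real.log T *
      (truncWeight T p.1.1 * truncWeight T p.1.2 / |deBruijnZeroZ t p.1.1 - deBruijnZeroZ t p.1.2|)) ∧
    (∀ C c : ℝ, 0 < C → 0 < c → IsNegligible t₀ (fun T t p ↦
      if |(p.1.1 : ℝ)| ≤ T ^ (1 - c) ∧ |(p.1.2 : ℝ)| ≤ T ^ (1 - c) then Real.log T ^ C *
        (truncWeight T p.1.1 * truncWeight T p.1.2 / |deBruijnZeroZ t p.1.1 - deBruijnZeroZ t p.1.2|)
      else 0)) ∧
    (∀ C c : ℝ, 0 < C → 0 < c → IsNegligible t₀ (fun T t p ↦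
      if T ^ (1 + c) ≤ |(p.1.1 : ℝ)| ∧ T ^ (1 + c) ≤ |(p.1.2 : ℝ)| then Real.log T ^ C *
        (truncWeight T p.1.1 * truncWeight T p.1.2 / |deBruijnZeroZ t p.1.1 - deBruijnZeroZ t p.1.2|)
      else 0))

/-- VACUOUS-AS-PRINTED (Λ ≥ 0) / EX-FALSO class — NAMED FACT. Rodgers–Tao 2020, **Lemma 21**,
last clause (= arXiv v4 Lemma 7.6; FMP p. 47): «Similarly if the `x_i(t)` are replaced by `ξ_i`
throughout», i.e. items (i)–(iv) with the classical locations `ξ_j` in place of the zeros, in the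
same «moderately sized» / «negligible» sense (`O` / `o_{T→∞}(T log³₊ T + Ẽ_T(t))`, `Λ/2 ≤ t ≤ 0`).
Typed LITERALLY (witness form, `IsModeratelySized` / `IsNegligible`), although the `ξ`-sums do not
depend on `t`: see the module docstring («Possible gap in print») for why the `t`-free
`O(T log³ T)` form is NOT typed for item (ii). The RH-FREE displays of the printed proof
(p. 47 last display, p. 48 first display) are the separate facts `rodgers_tao_xi_inv_sq_sum_bound`,
`rodgers_tao_truncWeight_xi_sq_sum_bound`. Typed range / EX-FALSO: as Lemma 16. Users take
`(h : rodgers_tao_moderatelySized_xi)`.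
[cite: RodgersTaoFMP2020, Lemma 21 p. 47 («similarly if the x_i are replaced by ξ_i»)] -/
def rodgers_tao_moderatelySized_xi : Prop :=
  ∀ t₀ : ℝ, t₀ < 0 → HasOnlyRealZeros (deBruijnH t₀) →
    IsModeratelySized t₀ (fun T _ p ↦
      truncWeight T p.1.1 * truncWeight T p.1.2 /
        (classicalLocationZ p.1.1 - classicalLocationZ p.1.2) ^ 2) ∧
    IsModeratelySized t₀ (fun T _ p ↦ Real.log T *
      (truncWeight T p.1.1 * truncWeight T p.1.2 /
        |classicalLocationZ p.1.1 - classicalLocationZ p.1.2|)) ∧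
    (∀ C c : ℝ, 0 < C → 0 < c → IsNegligible t₀ (fun T _ p ↦
      if |(p.1.1 : ℝ)| ≤ T ^ (1 - c) ∧ |(p.1.2 : ℝ)| ≤ T ^ (1 - c) then Real.log T ^ C *
        (truncWeight T p.1.1 * truncWeight T p.1.2 /
          |classicalLocationZ p.1.1 - classicalLocationZ p.1.2|)
      else 0)) ∧
    (∀ C c : ℝ, 0 < C → 0 < c → IsNegligible t₀ (fun T _ p ↦
      if T ^ (1 + c) ≤ |(p.1.1 : ℝ)| ∧ T ^ (1 + c) ≤ |(p.1.2 : ℝ)| then Real.log T ^ C *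
        (truncWeight T p.1.1 * truncWeight T p.1.2 /
          |classicalLocationZ p.1.1 - classicalLocationZ p.1.2|)
      else 0))

/-- RH-FREE — NAMED FACT. Rodgers–Tao 2020, proof of **Lemma 21**, last display of FMP p. 47:
«From (44), we see that `Σ_{k : k ≠ j} 1/|ξ_j − ξ_k|² ≪ log²₊ j` for all `j ∈ ℤ*`» (indices in `ℤ*`).
Typed: there is `C` such that for every `j ∈ ℤ*` the family `k ↦ 1/(ξ_j − ξ_k)²` on
`k ∈ ℤ* ∖ {j}` is summable with sum `≤ C log₊² j`. A statement about the classical locations only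
(input: Lemma 8 (ii), display (44)); no hypothesis on `Λ`. Users take
`(h : rodgers_tao_xi_inv_sq_sum_bound)`.
[cite: RodgersTaoFMP2020, Lemma 21 p. 47 (proof, last display)] -/
def rodgers_tao_xi_inv_sq_sum_bound : Prop :=
  ∃ C : ℝ, ∀ j : ℤ, j ≠ 0 →
    Summable (fun k : zstarCompl {j} ↦ 1 / (classicalLocationZ j - classicalLocationZ k) ^ 2) ∧
    ∑' k : zstarCompl {j}, 1 / (classicalLocationZ j - classicalLocationZ k) ^ 2 ≤
      C * logPlus j ^ 2

/-- RH-FREE — NAMED FACT. Rodgers–Tao 2020, proof of **Lemma 21**, first display of FMP p. 48: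
«and hence `Σ_{j,k : j ≠ k} ψ_T(j)ψ_T(k)/|ξ_j − ξ_k|² ≪ T log³₊ T`» (indices in `ℤ*`; `T` large,
p. 42). Typed: there are `C`, `T₁` such that for all `T ≥ T₁` the family
`(j,k) ↦ ψ_T(j)ψ_T(k)/(ξ_j − ξ_k)²` on the pairs `j ≠ k` in `ℤ*` is summable with sum
`≤ C T log³ T` (`log₊ T ↦ log T`, `T` large). A statement about `ξ_j` and `ψ_T` only (inputs:
(44), (66)); no hypothesis on `Λ`. Users take `(h : rodgers_tao_truncWeight_xi_sq_sum_bound)`.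
[cite: RodgersTaoFMP2020, Lemma 21 p. 48 (proof, first display)] -/
def rodgers_tao_truncWeight_xi_sq_sum_bound : Prop :=
  ∃ C T₁ : ℝ, ∀ T : ℝ, T₁ ≤ T →
    Summable (fun p : zstarOffDiag ↦ truncWeight T p.1.1 * truncWeight T p.1.2 /
      (classicalLocationZ p.1.1 - classicalLocationZ p.1.2) ^ 2) ∧
    ∑' p : zstarOffDiag, truncWeight T p.1.1 * truncWeight T p.1.2 /
      (classicalLocationZ p.1.1 - classicalLocationZ p.1.2) ^ 2 ≤ C * (T * Real.log T ^ 3)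

/-- VACUOUS-AS-PRINTED (Λ ≥ 0) / EX-FALSO class — NAMED FACT. Rodgers–Tao 2020,
**Proposition 22** (= arXiv v4 Prop. 7.7; FMP p. 48, display (76)): «In the range `Λ/2 ≤ t ≤ 0`,
the function `H̃_T` is absolutely continuous, and the derivative `∂ₜ H̃_T(t)` is equal to
`−4 Ẽ_T(t)` plus negligible terms for almost all `t`. In other words, one has
`∂ₜ H̃_T(t) = −4 Ẽ_T(t) + o_{T→∞}(T log³ T + Ẽ_T(t))` (76) for almost every `t`», `T` being large.
Typed (witness form): for every `t₀ < 0` with `H_{t₀}` real-rooted and every `ε > 0` there is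
`T₁` such that for all `T ≥ T₁`: `t ↦ H̃_T(t)` is `AbsolutelyContinuousOnInterval` on
`[t₀/2, 0]`, and for a.e. `t ∈ [t₀/2, 0]`, `Ẽ_T(t)` is finite (summable) and
`|deriv H̃_T (t) + 4 Ẽ_T(t)| ≤ ε (T log³ T + Ẽ_T(t))`. Typed range / EX-FALSO: as Lemma 16; the
decay rate is uniform in `t` (Cor. 25 uses it so); «`H_T`» in the printed first sentence read
`H̃_T` (module docstring). Inputs of the printed proof: (56), (77)–(78), Prop. 15, Lemmas 18, 21,
(72)–(73). Users take `(h : rodgers_tao_truncHamiltonian_deriv)`.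
[cite: RodgersTaoFMP2020, Prop. 22 p. 48 (76) (= arXiv:1801.05914v4 Prop. 7.7)] -/
def rodgers_tao_truncHamiltonian_deriv : Prop :=
  ∀ t₀ : ℝ, t₀ < 0 → HasOnlyRealZeros (deBruijnH t₀) →
    ∀ ε : ℝ, 0 < ε → ∃ T₁ : ℝ, ∀ T : ℝ, T₁ ≤ T →
      AbsolutelyContinuousOnInterval (truncHamiltonian T) (t₀ / 2) 0 ∧
      ∀ᵐ t ∂(volume.restrict (Icc (t₀ / 2) 0)),
        Summable (truncEnergyTerm T t) ∧
        |deriv (truncHamiltonian T) t + 4 * truncEnergy T t| ≤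
          ε * (T * Real.log T ^ 3 + truncEnergy T t)

/-- VACUOUS-AS-PRINTED (Λ ≥ 0) / EX-FALSO class — NAMED FACT. Rodgers–Tao 2020, **Lemma 24**
(= arXiv v4 Lemma 7.9; FMP p. 54): «Let `m` be a natural number, and let `Λ/2 ≤ t ≤ 0`. Let
`T > 0`, and let `δ = δ(T)` go to zero as `T → ∞` sufficiently slowly. If `H̃_T(t) ≥ δ m T log³₊ T`,
then `Ẽ_T(t) ≫ δ 2^{2m} T log³₊ T`, where the implied constant is absolute.» Typed (witness form):
for every `t₀ < 0` with `H_{t₀}` real-rooted there are a threshold rate `δ₀ > 0`, `δ₀(T) → 0`, and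
an absolute `c > 0` such that for every positive `δ(T) → 0` with `δ₀ ≤ δ` eventually there is `T₁`
with: for all `T ≥ T₁`, `t₀/2 ≤ t ≤ 0`, `m ≥ 1`, if `H̃_T(t) ≥ δ(T) m T log³ T` and `Ẽ_T(t)` is
finite then `Ẽ_T(t) ≥ c δ(T) 2^{2m} T log³ T`. Typed range / EX-FALSO: as Lemma 16. Divergences:
«sufficiently slowly» as a threshold rate (module docstring); `m ≥ 1` (module docstring); the case
`Ẽ_T(t) = +∞`, trivially true in the source, is the `Summable` hypothesis. Inputs of the printed
proof: Lemmas 19, 20, (69), (70), (45), (50), (62). Users take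
`(h : rodgers_tao_truncEnergy_lower_bound)`.
[cite: RodgersTaoFMP2020, Lemma 24 p. 54 (= arXiv:1801.05914v4 Lemma 7.9)] -/
def rodgers_tao_truncEnergy_lower_bound : Prop :=
  ∀ t₀ : ℝ, t₀ < 0 → HasOnlyRealZeros (deBruijnH t₀) →
    ∃ δ₀ : ℝ → ℝ, (∀ T, 0 < δ₀ T) ∧ Tendsto δ₀ atTop (𝓝 0) ∧
    ∃ c : ℝ, 0 < c ∧
      ∀ δ : ℝ → ℝ, (∀ T, 0 < δ T) → Tendsto δ atTop (𝓝 0) → (∀ᶠ T in atTop, δ₀ T ≤ δ T) →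
        ∃ T₁ : ℝ, ∀ T : ℝ, T₁ ≤ T → ∀ t : ℝ, t₀ / 2 ≤ t → t ≤ 0 → ∀ m : ℕ, 1 ≤ m →
          δ T * m * (T * Real.log T ^ 3) ≤ truncHamiltonian T t →
          Summable (truncEnergyTerm T t) →
            c * (δ T * 2 ^ (2 * m) * (T * Real.log T ^ 3)) ≤ truncEnergy T t

/-- VACUOUS-AS-PRINTED (Λ ≥ 0) / EX-FALSO class — NAMED FACT. Rodgers–Tao 2020, **Corollary 25**
(= arXiv v4 Cor. 7.10; FMP p. 56): «One has `H̃_T(t) = O(δ T log³₊ T)` for `Λ/4 ≤ t ≤ 0`», with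
`δ = δ(T) → 0` sufficiently slowly as in Lemma 24 and `T` large (proof, p. 56: «We may take `T` to
be large»; the constant absorbs `m₀` and `|Λ|`). Typed (witness form): for every `t₀ < 0` with
`H_{t₀}` real-rooted there are a threshold rate `δ₀ > 0`, `δ₀(T) → 0`, and `C` such that for every
positive `δ(T) → 0` with `δ₀ ≤ δ` eventually there is `T₁` with `|H̃_T(t)| ≤ C δ(T) T log³ T` for
all `T ≥ T₁` and `t₀/4 ≤ t ≤ 0`. Typed range / EX-FALSO: printed `Λ/4 ≤ t ≤ 0` under `Λ < 0`; as
Lemma 16. Inputs of the printed proof: Prop. 22, Lemma 24, the fundamental theorem of calculus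
for absolutely continuous functions, the intermediate value theorem. Users take
`(h : rodgers_tao_truncHamiltonian_bound)`.
[cite: RodgersTaoFMP2020, Cor. 25 p. 56 (= arXiv:1801.05914v4 Cor. 7.10)] -/
def rodgers_tao_truncHamiltonian_bound : Prop :=
  ∀ t₀ : ℝ, t₀ < 0 → HasOnlyRealZeros (deBruijnH t₀) →
    ∃ δ₀ : ℝ → ℝ, (∀ T, 0 < δ₀ T) ∧ Tendsto δ₀ atTop (𝓝 0) ∧
    ∃ C : ℝ,
      ∀ δ : ℝ → ℝ, (∀ T, 0 < δ T) → Tendsto δ atTop (𝓝 0) → (∀ᶠ T in atTop, δ₀ T ≤ δ T) →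
        ∃ T₁ : ℝ, ∀ T : ℝ, T₁ ≤ T → ∀ t : ℝ, t₀ / 4 ≤ t → t ≤ 0 →
          |truncHamiltonian T t| ≤ C * (δ T * (T * Real.log T ^ 3))

end Literature.NumberTheory.LFunctions

end
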